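import Summits.HubbardSuperconductivity.HubbardSuperconductivity.Theorems.KLProgrammeKLRegimeScaleZeroMatsubaraWindowAbel
import Summits.HubbardSuperconductivity.HubbardSuperconductivity.Theorems.KLProgrammeKLRegimeScaleZeroCovarianceFreqMomentumJets
import Summits.HubbardSuperconductivity.HubbardSuperconductivity.Theorems.KLProgrammeKLRegimeScaleZeroCovarianceOffSiteContrForm
import Summits.HubbardSuperconductivity.HubbardSuperconductivity.Theorems.KLProgrammeKLRegimeScaleZeroCovarianceOffSiteSpatialEnvelope
import Summits.HubbardSuperconductivity.HubbardSuperconductivity.Theorems.KLProgrammeKLRegimeScaleZeroDetBoundFreeBandSharp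
import Summits.HubbardSuperconductivity.HubbardSuperconductivity.Theorems.KLProgrammeScaleZeroCovarianceMomentumJetsTab

/-!
# Route `KLProgramme`, crux K3 — engine-flow child (stmt-HubbardSuperconductivity-20437), stub (C) at `n = 0`, located brick «A-SIZES-WEIGHTED» (pen (R181)),
# brick 4c: POINTWISE BOUNDS FOR THE ENTRIES of `S_gridᵀ C⁰_{>Λ} S_grid` at the bare frame — the window sum with its grid phase, its frequency jets,
# the Δτ-uniform bounds (Gram `16`; off-site `O((1+‖z‖)⁻ⁿ)`), and the Abel time-decay bound

Cell gate-hubbard-kl, seat p1 g21.  For grid points `p₁ = (j₁,x₁)`, `p₀ = (j₀,x₀)` of the `N`-point grid the `(+,−)` entry of equal spin is the window sum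
`(1/β)Σ_{i<2M} e^{iω_iΔτ} H_z(ω_i)` with the per-frequency torus factor `H_z(ω) = L⁻²Σ_k χ_k(z̄) Ψ¹(ω, e₀(k))` (`z̄ = x₁ − x₀ = proj z` for ANY
representative `z`; `gridCov_hubbardCovAboveCT_apply_eq_sum_freqTerm` + `freqTerm_eq_torusFourierInv_one`).  This file supplies:

* §1 `norm_torusFourierInv_le_of_forall_le`, `contDiff_freq_torusFourierInv_uvSpatialSample`, **`norm_iteratedDeriv_freq_torusFourierInv_uvSpatialSample_le`**
  (`‖∂_ωⁱH_z(ω)‖ ≤ c·B·(i+1)!·(2/m(ω))^{i+1}`, every site), and the two JET PACKAGES in the `A_i/m(ω)^{i+1}` format of brick 4b: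
  `freqJets_torusFourierInv_allSites` (every `z`), `freqJets_torusFourierInv_offSite` (centred off-site `z`, with `(1+‖z‖)⁻ⁿ`);
* §2 **`gridCov_apply_eq_phase_mul_windowSum`** — the entry `= (1/β)·e^{iω₀Δτ}·Σ_{n<2M} qⁿ·H_z(ω₀ + n·2π/β)`, `q = e^{2πi(j₁−j₀)/N}`;
* §3 the Δτ-UNIFORM bounds: **`norm_gridCov_apply_le_sixteen`** (every entry, Gram, under `klEngL₃ β U ≤ L`) and **`norm_gridCov_apply_le_offSite_uniform`**
  (`‖A‖ ≤ 4C_n(z)·(2/Λ)`, `C_n(z) = n!·Tab(n)·(n+1)!·max(1,4/Λ)^{n−1}·8ⁿ·(1+4ⁿS_n)·(1+‖z‖)⁻ⁿ`, β-, M-, L-uniform);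
* §4 **`norm_gridCov_apply_le_of_freqJets`** — the ABEL bound: `‖A‖ ≤ Σ_{i<N′} 2max(i,1)2ⁱA_i/(π v^{i+1}) + N′A_{N′}·2π(2/Λ)^{N′}(2π/β)^{N′−1}(M/v)^{N′}/β`,
  `v = cyclicDist_N(j₁, j₀) > 0`, on the `N = 4M` grid.

Proofs only; no definitions; nothing here asserts (C), any stub of 20437, K3 or superconductivity.  References: BGM 2006 §2.1–§2.2 (2.3)–(2.6a), (2.36aa)
[cite: BenfattoGiulianiMastropietro2006]; Salmhofer 1999 §4.2.4 (4.63) [cite: Salmhofer1999]; de Siqueira Pedra–Salmhofer 2008 Thm 1.3 [cite: PedraSalmhofer2008].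
-/

noncomputable section

namespace Summit.HubbardSuperconductivity.HubbardSuperconductivity.Theorems.KLRegimeSplit

set_option linter.dupNamespace false -- summit = problem name (single-conjunct summit), D-0017

open Literature.MathematicalPhysics.QuantumLattice Literature.Probability.LatticeModels Literature.Analysis.FunctionSpaces
open Summit.HubbardSuperconductivity.HubbardSuperconductivity.Theorems.DispersionFlow
open MeasureTheory Set Finset Complex Real GrassmannAlgebra
open scoped Nat fwdDiff

variable {L M : ℕ} [NeZero L]

/-! ## §1 The per-frequency torus factor: sup bound, smoothness, jets -/

/-- `‖torusFourierInv g x‖ ≤ B` when `‖g k‖ ≤ B` for every `k` (the normalised character sum). -/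
theorem norm_torusFourierInv_le_of_forall_le {d : ℕ} {g : TorusSite d L → ℂ} {B : ℝ} (hg : ∀ k, ‖g k‖ ≤ B) (x : TorusSite d L) :
    ‖torusFourierInv g x‖ ≤ B := by
  have hL : (0 : ℝ) < L := by exact_mod_cast Nat.pos_of_ne_zero (NeZero.ne L)
  have hcard : (Fintype.card (TorusSite d L) : ℝ) = (L : ℝ) ^ d := by
    rw [Fintype.card_pi, Finset.prod_const, ZMod.card, Finset.card_univ, Fintype.card_fin]; push_cast; rfl
  rw [torusFourierInv_eq_sum_torusChar, norm_mul, norm_inv, norm_pow, Complex.norm_natCast]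
  have hsum : ‖∑ k, g k * torusChar k x‖ ≤ (L : ℝ) ^ d * B := by
    refine (norm_sum_le _ _).trans ?_
    calc ∑ k, ‖g k * torusChar k x‖ ≤ ∑ _k : TorusSite d L, B := Finset.sum_le_sum fun k _ => by
            rw [norm_mul, norm_torusChar, mul_one]; exact hg k
      _ = (L : ℝ) ^ d * B := by rw [Finset.sum_const, Finset.card_univ, nsmul_eq_mul, hcard]
  have hLd : (0 : ℝ) < (L : ℝ) ^ d := by positivity
  calc ((L : ℝ) ^ d)⁻¹ * ‖∑ k, g k * torusChar k x‖ ≤ ((L : ℝ) ^ d)⁻¹ * ((L : ℝ) ^ d * B) :=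
        mul_le_mul_of_nonneg_left hsum (by positivity)
    _ = B := by field_simp

/-- **`ω ↦ H_z(ω) = L⁻²Σ_k χ_k(x)Ψ^c(ω, e_K(2πk/L))` is `C^∞`** (`0 < Λ`). -/
theorem contDiff_freq_torusFourierInv_uvSpatialSample (c : ℝ) {Λ : ℝ} (hΛ : 0 < Λ) (μ : ℝ) (K : TrigPolyC4v) (x : TorusSite 2 L) {m : ℕ∞} :
    ContDiff ℝ m (fun om : ℝ => torusFourierInv (fun kv : TorusSite 2 L =>
        (fun y : Momentum => uvSymbolFn c Λ (frameLevel μ K ((2 * π) • y)) om) (WithLp.toLp 2 fun i => ((kv i).val : ℝ) / L)) x) := by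
  simp only [torusFourierInv_eq_sum_torusChar]
  have hline : ∀ e : ℝ, ContDiff ℝ m (fun om : ℝ => fbPt om e) := fun e => by
    show ContDiff ℝ m (fun om : ℝ => om • fbE0 + e • fbE1)
    exact (contDiff_id.smul contDiff_const).add contDiff_const
  refine contDiff_const.mul (ContDiff.sum fun kv _ => ContDiff.mul ?_ contDiff_const)
  have hfun : uvSymbolFn c Λ (frameLevel μ K ((2 * π) • (WithLp.toLp 2 fun i => ((kv i).val : ℝ) / L : Momentum))) =
      fun om : ℝ => uvSymbol₂ c Λ (fbPt om (frameLevel μ K ((2 * π) • (WithLp.toLp 2 fun i => ((kv i).val : ℝ) / L : Momentum)))) := by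
    funext om; rw [uvSymbol₂_fbPt]
  rw [hfun]
  exact (contDiff_uvSymbol₂ c hΛ).comp (hline _)

/-- **Frequency jets of the torus factor at every site**: `‖∂_ωᴺ H_z(ω)‖ ≤ c·B·(N+1)!·(2/max(|ω|,Λ/2))^{N+1}` (table `B ≥ 1` to order `N`, `0 ≤ c`). -/
theorem norm_iteratedDeriv_freq_torusFourierInv_uvSpatialSample_le {c Λ : ℝ} (hc : 0 ≤ c) (hΛ : 0 < Λ) (μ : ℝ) (K : TrigPolyC4v) (N : ℕ)
    {B : ℝ} (hB1 : 1 ≤ B) (hB : ∀ j ≤ N, ∀ t, ‖iteratedDeriv j salmhoferCutoff t‖ ≤ B) (x : TorusSite 2 L) (om : ℝ) :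
    ‖iteratedDeriv N (fun om : ℝ => torusFourierInv (fun kv : TorusSite 2 L =>
        (fun y : Momentum => uvSymbolFn c Λ (frameLevel μ K ((2 * π) • y)) om) (WithLp.toLp 2 fun i => ((kv i).val : ℝ) / L)) x) om‖ ≤
      c * B * (N + 1) ! * (2 / max |om| (Λ / 2)) ^ (N + 1) := by
  rw [iteratedDeriv_freq_torusFourierInv_uvSpatialSample c hΛ μ K N x om]
  exact norm_torusFourierInv_le_of_forall_le (fun kv => norm_iterate_freqDeriv_uvSymbol₂_fbPt_le hc hΛ N hB1 hB om _) x

/-- **Jet package at EVERY site** (table `klChi2CauchyTab N′`): for `i ≤ N′`,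
`‖∂_ωⁱ H¹_z(ω)‖ ≤ (klChi2CauchyTab N′·(i+1)!·2^{i+1}) / max(|ω|,Λ/2)^{i+1}`. -/
theorem freqJets_torusFourierInv_allSites {Λ : ℝ} (hΛ : 0 < Λ) (μ : ℝ) (K : TrigPolyC4v) (N' : ℕ) (x : TorusSite 2 L) :
    ∀ i ≤ N', ∀ om : ℝ, ‖iteratedDeriv i (fun om : ℝ => torusFourierInv (fun kv : TorusSite 2 L =>
        (fun y : Momentum => uvSymbolFn 1 Λ (frameLevel μ K ((2 * π) • y)) om) (WithLp.toLp 2 fun i => ((kv i).val : ℝ) / L)) x) om‖ ≤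
      (klChi2CauchyTab N' * (i + 1) ! * 2 ^ (i + 1)) / max |om| (Λ / 2) ^ (i + 1) := by
  intro i hi om
  have h := norm_iteratedDeriv_freq_torusFourierInv_uvSpatialSample_le zero_le_one hΛ μ K i (one_le_klChi2CauchyTab N')
    (fun j hj t => salmhoferCutoff_flat_cauchy_table_deriv N' j (hj.trans hi) t) x om
  rw [one_mul, div_pow] at h
  simpa only [mul_div_assoc] using h

/-- **Jet package OFF SITE, centred representative** (`2‖z‖_∞ ≤ L`, `z̄ ≠ 0`, `n ≥ 4`; brick 1, bare frame `K = 0`): for every `i`,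
`‖∂_ωⁱ H¹_z(ω)‖ ≤ [n!·klChi2CauchyTab(i+n)·(i+n+1)!·2^{i+2}·(2/Λ)·max(1,4/Λ)^{n−1}·8ⁿ·(1+4ⁿS_n)·(1+‖z‖)⁻ⁿ] / max(|ω|,Λ/2)^{i+1}`. -/
theorem freqJets_torusFourierInv_offSite {Λ : ℝ} (hΛ : 0 < Λ) (μ : ℝ) {n : ℕ} (hn : 2 * 2 ≤ n) {z : Site 2} (hz : 2 * ‖z‖ ≤ L)
    (hz0 : Torus.proj L z ≠ 0) (i : ℕ) (om : ℝ) :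
    ‖iteratedDeriv i (fun om : ℝ => torusFourierInv (fun kv : TorusSite 2 L =>
        (fun y : Momentum => uvSymbolFn 1 Λ (frameLevel μ 0 ((2 * π) • y)) om) (WithLp.toLp 2 fun i => ((kv i).val : ℝ) / L)) (Torus.proj L z)) om‖ ≤
      (n ! * klChi2CauchyTab (i + n) * (i + n + 1) ! * 2 ^ (i + 2) * (2 / Λ) * (max 1 (4 / Λ)) ^ (n - 1) * 8 ^ n *
          (1 + (4 : ℝ) ^ n * ∑' k : Site 2, ((1 + ‖k‖) ^ n)⁻¹) * ((1 + ‖z‖) ^ n)⁻¹) / max |om| (Λ / 2) ^ (i + 1) := by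
  have h := norm_iteratedDeriv_freq_torusFourierInv_uvSpatialSample_le_offSite_bare zero_le_one hΛ μ i hn hz hz0 om
  refine h.trans ?_
  have hm : 0 < max |om| (Λ / 2) := lt_max_of_lt_right (by positivity)
  have hm2 : Λ / 2 ≤ max |om| (Λ / 2) := le_max_right _ _
  have hS : 0 ≤ ∑' k : Site 2, ((1 + ‖k‖) ^ n)⁻¹ := tsum_nonneg fun _ => by positivity
  have hT : 0 ≤ klChi2CauchyTab (i + n) := zero_le_one.trans (one_le_klChi2CauchyTab _)
  -- `(2/m)^{i+2} ≤ 2^{i+2}(2/Λ)/m^{i+1}` and `max(1,2/m) ≤ max(1,4/Λ)`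
  have h1 : (2 / max |om| (Λ / 2)) ^ (i + 2) ≤ 2 ^ (i + 2) * (2 / Λ) / max |om| (Λ / 2) ^ (i + 1) := by
    rw [div_pow, pow_succ (max |om| (Λ / 2)) (i + 1), le_div_iff₀ (by positivity)]
    have h2m : 1 / max |om| (Λ / 2) ≤ 2 / Λ := by
      rw [div_le_div_iff₀ hm hΛ]; linarith
    have : (2 : ℝ) ^ (i + 2) / (max |om| (Λ / 2) ^ (i + 1) * max |om| (Λ / 2)) * max |om| (Λ / 2) ^ (i + 1) =
        2 ^ (i + 2) * (1 / max |om| (Λ / 2)) := by field_simp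
    rw [this]
    exact mul_le_mul_of_nonneg_left h2m (by positivity)
  have h2 : max 1 (2 / max |om| (Λ / 2)) ≤ max 1 (4 / Λ) := by
    refine max_le_max le_rfl ?_
    rw [div_le_div_iff₀ hm hΛ]; linarith
  have h2' : (max 1 (2 / max |om| (Λ / 2))) ^ (n - 1) ≤ (max 1 (4 / Λ)) ^ (n - 1) :=
    pow_le_pow_left₀ (le_trans zero_le_one (le_max_left _ _)) h2 _
  have h8 : ((2 * π) * 4) ^ n / Real.pi ^ n = (8 : ℝ) ^ n := by
    rw [← div_pow]; congr 1; field_simp; ring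
  calc (n ! * (1 * klChi2CauchyTab (i + n) * (i + n + 1) ! * (2 / max |om| (Λ / 2)) ^ (i + 2) * (max 1 (2 / max |om| (Λ / 2))) ^ (n - 1)) *
          ((2 * π) * 4) ^ n) / Real.pi ^ n * (1 + (4 : ℝ) ^ n * ∑' k : Site 2, ((1 + ‖k‖) ^ n)⁻¹) * ((1 + ‖z‖) ^ n)⁻¹
      = n ! * klChi2CauchyTab (i + n) * (i + n + 1) ! * ((2 / max |om| (Λ / 2)) ^ (i + 2) * (max 1 (2 / max |om| (Λ / 2))) ^ (n - 1)) *
          (((2 * π) * 4) ^ n / Real.pi ^ n) * (1 + (4 : ℝ) ^ n * ∑' k : Site 2, ((1 + ‖k‖) ^ n)⁻¹) * ((1 + ‖z‖) ^ n)⁻¹ := by ring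
    _ ≤ n ! * klChi2CauchyTab (i + n) * (i + n + 1) ! * ((2 ^ (i + 2) * (2 / Λ) / max |om| (Λ / 2) ^ (i + 1)) * (max 1 (4 / Λ)) ^ (n - 1)) *
          (((2 * π) * 4) ^ n / Real.pi ^ n) * (1 + (4 : ℝ) ^ n * ∑' k : Site 2, ((1 + ‖k‖) ^ n)⁻¹) * ((1 + ‖z‖) ^ n)⁻¹ := by
        gcongr
    _ = _ := by rw [h8]; ring

/-! ## §2 The entry as a window sum with its grid phase -/

/-- **THE ENTRY AS A PHASED WINDOW SUM**: for `0 < β`, grid points `p₁ = (j₁,x₁)`, `p₀ = (j₀,x₀)` of the `N`-point grid, equal spins and ANY representative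
`z` of `x₁ − x₀`:  `A((p₁,σ,+),(p₀,σ,−)) = (1/β)·e^{iω₀Δτ}·Σ_{n<2M} qⁿ·H¹_z(ω₀ + n·2π/β)`, `ω₀ = −π(2M−1)/β`, `Δτ = τ₁ − τ₀`, `q = e^{2πi(j₁−j₀)/N}`. -/
theorem gridCov_apply_eq_phase_mul_windowSum {β : ℝ} (hβ : 0 < β) (μ Λ : ℝ) {N : ℕ} [NeZero N] (p₁ p₀ : GridPoint L N) (σ : Fin 2)
    {z : Site 2} (hzx : Torus.proj L z = p₁.2 - p₀.2) :
    ((hubbardGridSub L M β N).transpose * hubbardCovAboveCT L M β μ 0 0 Λ * hubbardGridSub L M β N) ((p₁, σ), 0) ((p₀, σ), 1) =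
      ((1 / β : ℝ) : ℂ) * cexp (I * ((-(π * (2 * M - 1) / β) * (gridTime β N p₁.1 - gridTime β N p₀.1) : ℝ) : ℂ)) *
        ∑ n ∈ Finset.range (2 * M), cexp (I * ((2 * π * (((((p₁.1 : ℕ) : ℤ) - ((p₀.1 : ℕ) : ℤ) : ℤ) : ℝ) / (N : ℝ)) : ℝ) : ℂ)) ^ n *
          torusFourierInv (fun kv : TorusSite 2 L =>
            (fun y : Momentum => uvSymbolFn 1 Λ (frameLevel μ 0 ((2 * π) • y)) (-(π * (2 * M - 1) / β) + n * (2 * π / β)))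
              (WithLp.toLp 2 fun i => ((kv i).val : ℝ) / L)) (Torus.proj L z) := by
  have hN : (0 : ℝ) < N := by exact_mod_cast Nat.pos_of_ne_zero (NeZero.ne N)
  rw [gridCov_hubbardCovAboveCT_apply_eq_sum_freqTerm hβ μ Λ p₁ p₀ σ]
  have hrep : Torus.proj L (fun j => ((p₁.2 j).val : ℤ) - (p₀.2 j).val) = Torus.proj L z := by rw [torusProj_valSub_eq_sub, hzx]
  set Δτ : ℝ := gridTime β N p₁.1 - gridTime β N p₀.1 with hΔτ
  have hterm : ∀ i : MatsubaraIdx M,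
      ((1 / (β * (L : ℝ) ^ 2) : ℝ) : ℂ) ^ 2 * cexp (I * ((matsubaraFreq β M i * Δτ : ℝ) : ℂ)) *
          ∑ kv : TorusSite 2 L, torusChar kv (Torus.proj L fun j => ((p₁.2 j).val : ℤ) - (p₀.2 j).val) *
            uvSymbolFn (β * (L : ℝ) ^ 2) Λ (nambuXiCT L μ 0 kv) (matsubaraFreq β M i) =
        (fun om : ℝ => ((1 / β : ℝ) : ℂ) * cexp (I * ((om * Δτ : ℝ) : ℂ)) * torusFourierInv (fun kv : TorusSite 2 L =>
          (fun y : Momentum => uvSymbolFn 1 Λ (frameLevel μ 0 ((2 * π) • y)) om) (WithLp.toLp 2 fun i => ((kv i).val : ℝ) / L)) (Torus.proj L z))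
          (matsubaraFreq β M i) := by
    intro i
    rw [freqTerm_eq_torusFourierInv_one hβ Λ μ 0 (matsubaraFreq β M i) Δτ, hrep]
  rw [Finset.sum_congr rfl fun i _ => hterm i,
    sum_matsubaraIdx_eq_sum_range β M (fun om : ℝ => ((1 / β : ℝ) : ℂ) * cexp (I * ((om * Δτ : ℝ) : ℂ)) *
      torusFourierInv (fun kv : TorusSite 2 L => (fun y : Momentum => uvSymbolFn 1 Λ (frameLevel μ 0 ((2 * π) • y)) om)
        (WithLp.toLp 2 fun i => ((kv i).val : ℝ) / L)) (Torus.proj L z)),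
    Finset.mul_sum]
  refine Finset.sum_congr rfl fun n _ => ?_
  -- the phase of the `n`-th term: `e^{i(ω₀+nh)Δτ} = e^{iω₀Δτ}·qⁿ`
  have hphase : cexp (I * (((-(π * (2 * M - 1) / β) + n * (2 * π / β)) * Δτ : ℝ) : ℂ)) =
      cexp (I * ((-(π * (2 * M - 1) / β) * Δτ : ℝ) : ℂ)) *
        cexp (I * ((2 * π * (((((p₁.1 : ℕ) : ℤ) - ((p₀.1 : ℕ) : ℤ) : ℤ) : ℝ) / (N : ℝ)) : ℝ) : ℂ)) ^ n := by
    rw [← Complex.exp_nat_mul, ← Complex.exp_add]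
    congr 1
    have hΔ : Δτ = (((p₁.1 : ℕ) : ℝ) - ((p₀.1 : ℕ) : ℝ)) * β / N := by
      rw [hΔτ]; unfold gridTime; ring
    have hβC : (β : ℂ) ≠ 0 := by exact_mod_cast hβ.ne'
    have hNC : ((N : ℝ) : ℂ) ≠ 0 := by exact_mod_cast hN.ne'
    rw [hΔ]
    push_cast
    field_simp
  simp only []
  rw [hphase]
  ring

/-! ## §3 The Δτ-uniform bounds -/

/-- **Every entry is at most `16` in modulus** (bare frame, `μ ∈ klWindowC`, `klBetaMin ≤ β`, `klEngL₃ β U ≤ L`: the sharp replica-Gram constant `√16`). -/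
theorem norm_gridCov_apply_le_sixteen [NeZero M] {μ : ℝ} (hμ : μ ∈ klWindowC) {β U : ℝ} (hβ : klBetaMin ≤ β) (hL : EngineV8.klEngL₃ β U ≤ L)
    (X Y : GridLeg (GridPoint L (2 * (2 * M)))) :
    ‖((hubbardGridSub L M β (2 * (2 * M))).transpose * hubbardCovAboveCT L M β μ 0 0 klE0 * hubbardGridSub L M β (2 * (2 * M))) X Y‖ ≤ 16 := by
  have hGB := isGramBoundedR_scaleZero_free_sharp_klEngL₃ (L := L) (M := M) hμ hβ hL
  have h16 : Real.sqrt (2 * (7 + 1)) ^ 2 = 16 := by rw [Real.sq_sqrt (by norm_num)]; norm_num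
  rw [← norm_contr_gridCov_hubbardCovAboveCT, contr_apply, ← h16]
  exact IsGramBoundedR.norm_pairing_le hGB X Y

/-- **Off-site, uniformly in the time difference**: for `x₁ ≠ x₀` with centred representative `z` (`2‖z‖ ≤ L`, `proj z = x₁ − x₀`), `n ≥ 4`, `0 < β`, `0 < Λ`:
`‖A((p₁,σ,+),(p₀,σ,−))‖ ≤ 4·[n!·Tab(n)·(n+1)!·max(1,4/Λ)^{n−1}·8ⁿ·(1+4ⁿS_n)·(1+‖z‖)⁻ⁿ]·(2/Λ)` (window sum of the `N = 0` off-site bound `∝ (2/m)²`,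
`Σ_{window} m(ω_i)⁻² ≤ β·2/Λ`). -/
theorem norm_gridCov_apply_le_offSite_uniform {β : ℝ} (hβ : 0 < β) (μ : ℝ) {Λ : ℝ} (hΛ : 0 < Λ) {N : ℕ} [NeZero N] (p₁ p₀ : GridPoint L N)
    (σ : Fin 2) {n : ℕ} (hn : 2 * 2 ≤ n) {z : Site 2} (hz : 2 * ‖z‖ ≤ L) (hzx : Torus.proj L z = p₁.2 - p₀.2) (hx : p₁.2 ≠ p₀.2) :
    ‖((hubbardGridSub L M β N).transpose * hubbardCovAboveCT L M β μ 0 0 Λ * hubbardGridSub L M β N) ((p₁, σ), 0) ((p₀, σ), 1)‖ ≤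
      4 * (n ! * klChi2CauchyTab n * (n + 1) ! * (max 1 (4 / Λ)) ^ (n - 1) * 8 ^ n * (1 + (4 : ℝ) ^ n * ∑' k : Site 2, ((1 + ‖k‖) ^ n)⁻¹) *
        ((1 + ‖z‖) ^ n)⁻¹) * (2 / Λ) := by
  have hz0 : Torus.proj L z ≠ 0 := by rw [hzx]; exact sub_ne_zero.2 hx
  set C : ℝ := n ! * klChi2CauchyTab n * (n + 1) ! * (max 1 (4 / Λ)) ^ (n - 1) * 8 ^ n * (1 + (4 : ℝ) ^ n * ∑' k : Site 2, ((1 + ‖k‖) ^ n)⁻¹) *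
    ((1 + ‖z‖) ^ n)⁻¹ with hC
  have hS : 0 ≤ ∑' k : Site 2, ((1 + ‖k‖) ^ n)⁻¹ := tsum_nonneg fun _ => by positivity
  have hT : 0 ≤ klChi2CauchyTab n := zero_le_one.trans (one_le_klChi2CauchyTab _)
  have hC0 : 0 ≤ C := by positivity
  -- per frequency: `‖H_z(ω)‖ ≤ C·4/m(ω)²`
  have hpt : ∀ om : ℝ, ‖torusFourierInv (fun kv : TorusSite 2 L =>
      (fun y : Momentum => uvSymbolFn 1 Λ (frameLevel μ 0 ((2 * π) • y)) om) (WithLp.toLp 2 fun i => ((kv i).val : ℝ) / L)) (Torus.proj L z)‖ ≤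
      C * (4 * (1 / max |om| (Λ / 2) ^ 2)) := by
    intro om
    have h := norm_iteratedDeriv_freq_torusFourierInv_uvSpatialSample_le_offSite_bare zero_le_one hΛ μ 0 hn hz hz0 om
    rw [iteratedDeriv_zero] at h
    simp only [zero_add, one_mul] at h
    refine h.trans ?_
    have hm : 0 < max |om| (Λ / 2) := lt_max_of_lt_right (by positivity)
    have h2 : max 1 (2 / max |om| (Λ / 2)) ≤ max 1 (4 / Λ) := by
      refine max_le_max le_rfl ?_
      rw [div_le_div_iff₀ hm hΛ]; nlinarith [le_max_right |om| (Λ / 2)]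
    have h2' : (max 1 (2 / max |om| (Λ / 2))) ^ (n - 1) ≤ (max 1 (4 / Λ)) ^ (n - 1) :=
      pow_le_pow_left₀ (le_trans zero_le_one (le_max_left _ _)) h2 _
    have h8 : ((2 * π) * 4) ^ n / Real.pi ^ n = (8 : ℝ) ^ n := by
      rw [← div_pow]; congr 1; field_simp; ring
    have hsq : (2 / max |om| (Λ / 2)) ^ 2 = 4 * (1 / max |om| (Λ / 2) ^ 2) := by
      rw [div_pow]; ring
    calc (n ! * (klChi2CauchyTab n * (n + 1) ! * (2 / max |om| (Λ / 2)) ^ 2 * (max 1 (2 / max |om| (Λ / 2))) ^ (n - 1)) *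
          ((2 * π) * 4) ^ n) / Real.pi ^ n * (1 + (4 : ℝ) ^ n * ∑' k : Site 2, ((1 + ‖k‖) ^ n)⁻¹) * ((1 + ‖z‖) ^ n)⁻¹
        = n ! * klChi2CauchyTab n * (n + 1) ! * (max 1 (2 / max |om| (Λ / 2))) ^ (n - 1) * (((2 * π) * 4) ^ n / Real.pi ^ n) *
          (1 + (4 : ℝ) ^ n * ∑' k : Site 2, ((1 + ‖k‖) ^ n)⁻¹) * ((1 + ‖z‖) ^ n)⁻¹ * (4 * (1 / max |om| (Λ / 2) ^ 2)) := by
          rw [hsq]; ring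
      _ ≤ n ! * klChi2CauchyTab n * (n + 1) ! * (max 1 (4 / Λ)) ^ (n - 1) * (((2 * π) * 4) ^ n / Real.pi ^ n) *
          (1 + (4 : ℝ) ^ n * ∑' k : Site 2, ((1 + ‖k‖) ^ n)⁻¹) * ((1 + ‖z‖) ^ n)⁻¹ * (4 * (1 / max |om| (Λ / 2) ^ 2)) := by
          gcongr
      _ = C * (4 * (1 / max |om| (Λ / 2) ^ 2)) := by rw [hC, h8]
  rw [gridCov_hubbardCovAboveCT_apply_eq_sum_freqTerm hβ μ Λ p₁ p₀ σ]
  have hrep : Torus.proj L (fun j => ((p₁.2 j).val : ℤ) - (p₀.2 j).val) = Torus.proj L z := by rw [torusProj_valSub_eq_sub, hzx]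
  simp_rw [freqTerm_eq_torusFourierInv_one hβ Λ μ 0, hrep]
  refine (norm_sum_le _ _).trans ?_
  have hβn : ‖((1 / β : ℝ) : ℂ)‖ = 1 / β := by rw [Complex.norm_real, Real.norm_of_nonneg (by positivity)]
  calc ∑ i : MatsubaraIdx M, ‖((1 / β : ℝ) : ℂ) * cexp (I * ((matsubaraFreq β M i * (gridTime β N p₁.1 - gridTime β N p₀.1) : ℝ) : ℂ)) *
          torusFourierInv (fun kv : TorusSite 2 L => (fun y : Momentum => uvSymbolFn 1 Λ (frameLevel μ 0 ((2 * π) • y)) (matsubaraFreq β M i))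
            (WithLp.toLp 2 fun i => ((kv i).val : ℝ) / L)) (Torus.proj L z)‖
      ≤ ∑ i : MatsubaraIdx M, (1 / β) * (C * (4 * (1 / max |matsubaraFreq β M i| (Λ / 2) ^ 2))) := by
        refine Finset.sum_le_sum fun i _ => ?_
        rw [norm_mul, norm_mul, hβn, Complex.norm_exp_I_mul_ofReal, mul_one]
        exact mul_le_mul_of_nonneg_left (hpt _) (by positivity)
    _ = (1 / β) * (C * 4) * ∑ i : MatsubaraIdx M, 1 / max |matsubaraFreq β M i| (Λ / 2) ^ 2 := by
        rw [Finset.mul_sum]; exact Finset.sum_congr rfl fun i _ => by ring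
    _ ≤ (1 / β) * (C * 4) * (β * (2 / Λ)) :=
        mul_le_mul_of_nonneg_left (sum_matsubaraIdx_one_div_max_sq_le hβ hΛ M) (by positivity)
    _ = 4 * C * (2 / Λ) := by field_simp

/-! ## §4 The Abel time-decay bound for an entry -/

/-- **THE ABEL BOUND FOR AN ENTRY** on the `4M`-point grid: `0 < β`, `0 < Λ`, `M ≥ 2N′+1`, `N′ ≥ 1`, a representative `z` of `x₁ − x₀`, frequency jets
`‖∂_ωⁱH¹_z(ω)‖ ≤ A_i/max(|ω|,Λ/2)^{i+1}` (`i ≤ N′`, `A_i ≥ 0`), and DISTINCT grid times (`v = cyclicDist_{4M}(j₁,j₀) > 0`):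
`‖A((p₁,σ,+),(p₀,σ,−))‖ ≤ Σ_{i<N′} 2max(i,1)2ⁱA_i/(π·v^{i+1}) + N′·A_{N′}·(2π(2/Λ)^{N′})·(2π/β)^{N′−1}·(M/v)^{N′}/β`. -/
theorem norm_gridCov_apply_le_of_freqJets {β : ℝ} (hβ : 0 < β) (μ : ℝ) {Λ : ℝ} (hΛ : 0 < Λ) {N' : ℕ} (hN' : 1 ≤ N') (hM : 2 * N' + 1 ≤ M)
    (p₁ p₀ : GridPoint L (2 * (2 * M))) (σ : Fin 2) {z : Site 2} (hzx : Torus.proj L z = p₁.2 - p₀.2) {A : ℕ → ℝ} (hA0 : ∀ i, 0 ≤ A i)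
    (hjet : ∀ i ≤ N', ∀ om : ℝ, ‖iteratedDeriv i (fun om : ℝ => torusFourierInv (fun kv : TorusSite 2 L =>
        (fun y : Momentum => uvSymbolFn 1 Λ (frameLevel μ 0 ((2 * π) • y)) om) (WithLp.toLp 2 fun i => ((kv i).val : ℝ) / L)) (Torus.proj L z)) om‖ ≤
      A i / max |om| (Λ / 2) ^ (i + 1))
    (hv : 0 < cyclicDist (2 * (2 * M)) (((p₁.1 : ℕ) : ZMod (2 * (2 * M)))) (((p₀.1 : ℕ) : ZMod (2 * (2 * M))))) :
    ‖((hubbardGridSub L M β (2 * (2 * M))).transpose * hubbardCovAboveCT L M β μ 0 0 Λ * hubbardGridSub L M β (2 * (2 * M)))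
        ((p₁, σ), 0) ((p₀, σ), 1)‖ ≤
      (∑ i ∈ Finset.range N', 2 * ((max i 1 : ℕ) : ℝ) * 2 ^ i * A i /
          (π * cyclicDist (2 * (2 * M)) (((p₁.1 : ℕ) : ZMod (2 * (2 * M)))) (((p₀.1 : ℕ) : ZMod (2 * (2 * M)))) ^ (i + 1))) +
        N' * A N' * (2 * π * (2 / Λ) ^ N') * (2 * π / β) ^ (N' - 1) *
          ((M : ℝ) / cyclicDist (2 * (2 * M)) (((p₁.1 : ℕ) : ZMod (2 * (2 * M)))) (((p₀.1 : ℕ) : ZMod (2 * (2 * M))))) ^ N' / β := by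
  have hM0 : 0 < M := by omega
  haveI : NeZero (2 * (2 * M)) := ⟨by omega⟩
  set v : ℝ := cyclicDist (2 * (2 * M)) (((p₁.1 : ℕ) : ZMod (2 * (2 * M)))) (((p₀.1 : ℕ) : ZMod (2 * (2 * M)))) with hvdef
  set q : ℂ := cexp (I * ((2 * π * (((((p₁.1 : ℕ) : ℤ) - ((p₀.1 : ℕ) : ℤ) : ℤ) : ℝ) / ((2 * (2 * M) : ℕ) : ℝ)) : ℝ) : ℂ)) with hq
  have hq1 : ‖q‖ = 1 := by rw [hq, mul_comm, Complex.norm_exp_ofReal_mul_I]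
  have hqv : v / M ≤ ‖q - 1‖ := by
    have h := cyclicDist_div_le_norm_gridPhase_sub_one (2 * (2 * M)) (((p₁.1 : ℕ) : ℤ)) (((p₀.1 : ℕ) : ℤ))
    simp only [Int.cast_natCast] at h
    have hN : (((2 * (2 * M) : ℕ) : ℝ)) = 4 * M := by push_cast; ring
    rw [hN] at h
    have : 4 * v / (4 * (M : ℝ)) = v / M := by
      rw [mul_div_mul_left _ _ (by norm_num : (4 : ℝ) ≠ 0)]
    rw [hvdef, ← this]
    convert h using 2
    rw [hq, hN]
  rw [gridCov_apply_eq_phase_mul_windowSum hβ μ Λ p₁ p₀ σ hzx, norm_mul, norm_mul, Complex.norm_exp_I_mul_ofReal, mul_one,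
    Complex.norm_real, Real.norm_of_nonneg (by positivity : (0 : ℝ) ≤ 1 / β)]
  have hcd : ContDiff ℝ N' (fun om : ℝ => torusFourierInv (fun kv : TorusSite 2 L =>
      (fun y : Momentum => uvSymbolFn 1 Λ (frameLevel μ 0 ((2 * π) • y)) om) (WithLp.toLp 2 fun i => ((kv i).val : ℝ) / L)) (Torus.proj L z)) :=
    contDiff_freq_torusFourierInv_uvSpatialSample 1 hΛ μ 0 (Torus.proj L z) (m := (N' : ℕ∞))
  have hW := norm_windowSum_le_of_jets hN' hcd hΛ hA0 hjet hβ hM hq1 hv hqv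
  rw [one_div_mul_eq_div, div_le_iff₀ hβ, add_mul, div_mul_cancel₀ _ hβ.ne']
  calc _ ≤ _ := hW
    _ = _ := by ring

end Summit.HubbardSuperconductivity.HubbardSuperconductivity.Theorems.KLRegimeSplit

end
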